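import Literature.NumberTheory.Automorphic.AutomorphicGLnStrongMultiplicityOneProofs
import Literature.NumberTheory.Automorphic.GodementJacquetRankOneEntire

/-!
# Simultaneous spherical vector: a level supported on `S` for cuspidal `GL_n` unramified off `S`

Summit `Langlands`, sub-problem `Langlands`, helper file under `Theorems/` supporting the crux
`PairLBoundaryJS` (stmt-Langlands-13622, Arthur–Clozel (1989), Ch. 3, (2.2)), line `Sketch`, stub
`stub_ssv`.

`exists_level_supportedOn_of_isUnramifiedAt` (**main**): a cuspidal automorphic representation `Q` of
`GL_n(𝔸_K)` which is unramified (`IsUnramifiedAt`) at every finite place outside a set `S` has a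
non-zero vector fixed by a principal congruence subgroup `K(𝔫)`, `𝔫 ≠ 0`, all of whose prime divisors
lie in `S`. Classically this is read off Flath's factorisation `Q ≅ ⊗' Q_v` (`Q_v^{GL_n(𝒪_v)} ≠ 0` for
`v ∉ S`; Bump (1997), §3.3–3.4; Borel–Jacquet, Corvallis (1979), §4.6). Here it is proved WITHOUT the
tensor-product theorem, by a direct Hilbert-space argument in the irreducible unitary `Q ≤ L²_cusp`:

* `exists_inner_apply_ne_zero` (**non-orthogonality of translates**): for a topologically irreducible
  unitary `π` of `G = ι(G₀) · C_G(ι(G₀))` and a subgroup `U ≤ G₀` with `H^{ι(U)} ≠ 0`, no non-zero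
  `u` has all its translates `π(ι g) u`, `g ∈ G₀`, orthogonal to `H^{ι(U)}` — the translates
  `π(ι g) y`, `y ∈ H^{ι(U)}`, span a dense (closed `G`-stable, non-zero) subspace;
* `fixedPoints_ne_bot_of_level_peel` (**abstract peel**): if every `k` of a level `L'` factors as
  `k = c · ι(t)` with `t ∈ U` and `c ∈ L ∩ C_G(ι(G₀))`, then `H^L ≠ 0 ⟹ H^{L'} ≠ 0`: project a
  suitable translate `π(ι g) u` of `0 ≠ u ∈ H^L` orthogonally onto `H^{ι(U)}`; the projection is
  non-zero, `ι(U)`-fixed, and fixed by each such `c` (the projection commutes with `π(c)`);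
* `fixedVectors_principalCongruenceLevel_ne_bot_of_isUnramifiedAt` (**one-prime peel for `GL_n`**):
  `Q^{K(𝔭_v^e 𝔫')} ≠ 0`, `v ∤ 𝔫'`, `Q` unramified at `v` ⟹ `Q^{K(𝔫')} ≠ 0`
  (`K(𝔫') ∋ k = (k ι_v(k_v)⁻¹) · ι_v(k_v)`, `mul_ofLocal_toLocal_inv_mem_principalCongruenceLevel`);
* the main theorem peels, one prime at a time, the primes outside `S` of a level `𝔫₀` of `Q`
  (`exists_fixedVectors_principalCongruenceLevel_ne_bot_holds`).

`Ssv.stub_ssv` restates the main theorem verbatim in the registered stub signature.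

## References

* D. Flath, *Decomposition of representations into tensor products*, Corvallis (1979), Part 1,
  Thm. 3 [FlathCorvallis1979].
* D. Bump, *Automorphic forms and representations* (1997), §3.3 (`K(𝔫) = GL_n(𝒪_v) K(𝔫)^{(v)}`),
  Thm. 3.3.3 [Bump1997].
* A. Borel, H. Jacquet, *Automorphic forms and automorphic representations*, Corvallis (1979),
  Part 1, §4.6 [BorelJacquetCorvallis1979].
-/

noncomputable section

-- `Summit.Langlands.Langlands.…` (summit = sub-problem name, D-0017 layout) trips `dupNamespace`
set_option linter.dupNamespace false

open scoped MatrixGroups InnerProductSpace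
open NumberField IsDedekindDomain MeasureTheory
open Literature.NumberTheory.Automorphic AdelicGroupData

namespace Summit.Langlands.Langlands.Theorems

/-! ### Unitary representations: translates of the vectors fixed by a local compact subgroup -/

section Abstract

variable {G₀ G H : Type*} [Group G₀] [Group G] [NormedAddCommGroup H] [InnerProductSpace ℂ H]
  [CompleteSpace H]

omit [CompleteSpace H] in
/-- The `ι(U)`-fixed vectors are stable under the centraliser of `ι(G₀)`: for `c` commuting with
`ι(G₀)` and `y` fixed by `ι(U)`, `π(ι u) π(c) y = π(c) π(ι u) y = π(c) y`
(Bump (1997), §3.3: `Π^{K_v}` is a `G^{(v)}`-module). -/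
theorem apply_mem_fixedPoints_map_of_mem_centralizer (π : ContRepresentation ℂ G H) (ι : G₀ →* G)
    (U : Subgroup G₀) {c : G} (hc : c ∈ Subgroup.centralizer (Set.range ι)) {y : H}
    (hy : y ∈ π.toRepresentation.fixedPoints (U.map ι)) :
    π c y ∈ π.toRepresentation.fixedPoints (U.map ι) := by
  rw [Representation.mem_fixedPoints] at hy ⊢
  rintro _ ⟨t, ht, rfl⟩
  have hcomm : ι t * c = c * ι t := Subgroup.mem_centralizer_iff.1 hc (ι t) ⟨t, rfl⟩
  change π (ι t) (π c y) = π c y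
  rw [← mul_apply_eq_comp (π (ι t)) (π c) y, ← map_mul, hcomm, map_mul, mul_apply_eq_comp]
  exact congrArg (π c) (hy (ι t) ⟨t, ht, rfl⟩)

/-- **Non-orthogonality of translates.** Let `π` be a topologically irreducible unitary
representation of `G` on a Hilbert space, `ι : G₀ →* G` with `G = ι(G₀) · C_G(ι(G₀))`, and
`U ≤ G₀` a subgroup with a non-zero `ι(U)`-fixed vector `f`. Then for every `u ≠ 0` some translate
`π(ι g) u` is not orthogonal to the `ι(U)`-fixed vectors: otherwise `u` is orthogonal to all
`π(ι g) y`, `y ∈ H^{ι(U)}`, whose closed span is a non-zero closed `G`-stable subspace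
(`π(ι l · c) π(ι g) y = π(ι(l g)) (π(c) y)` with `π(c) y ∈ H^{ι(U)}`), hence everything
(Dixmier (1977), §13.1.5; Bump (1997), §3.3–3.4). -/
theorem exists_inner_apply_ne_zero {π : ContRepresentation ℂ G H} (hU : π.IsUnitary)
    (hirr : π.IsTopIrreducible) (ι : G₀ →* G)
    (hgen : ∀ x : G, ∃ (l : G₀) (c : G), c ∈ Subgroup.centralizer (Set.range ι) ∧ x = ι l * c)
    (U : Subgroup G₀) {f : H} (hf : f ∈ π.toRepresentation.fixedPoints (U.map ι)) (hf0 : f ≠ 0)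
    {u : H} (hu0 : u ≠ 0) :
    ∃ g : G₀, ∃ y ∈ π.toRepresentation.fixedPoints (U.map ι), ⟪y, π (ι g) u⟫_ℂ ≠ 0 := by
  by_contra! hall
  -- the translates `π (ι g) y` of the `ι(U)`-fixed vectors form a `G`-stable set `S`
  set S : Set H := {z : H | ∃ g : G₀, ∃ y ∈ π.toRepresentation.fixedPoints (U.map ι),
    z = π (ι g) y} with hS
  have hSmaps : ∀ x : G, Set.MapsTo (π x) S S := by
    rintro x _ ⟨g, y, hy, rfl⟩
    obtain ⟨l, c, hc, rfl⟩ := hgen x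
    have hcomm : ι g * c = c * ι g := Subgroup.mem_centralizer_iff.1 hc (ι g) ⟨g, rfl⟩
    refine ⟨l * g, π c y, apply_mem_fixedPoints_map_of_mem_centralizer π ι U hc hy, ?_⟩
    rw [← mul_apply_eq_comp (π (ι l * c)) (π (ι g)) y, ← map_mul, mul_assoc, ← hcomm,
      ← mul_assoc, ← map_mul ι, map_mul π, mul_apply_eq_comp]
  have hXmaps : ∀ x : G, Set.MapsTo (π x) (Submodule.span ℂ S : Set H) (Submodule.span ℂ S) := by
    intro x z hz
    have hle : (Submodule.span ℂ S).map (π x : H →L[ℂ] H).toLinearMap ≤ Submodule.span ℂ S := by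
      rw [Submodule.map_span_le]
      intro s hs
      exact Submodule.subset_span (hSmaps x hs)
    exact hle ⟨z, hz, rfl⟩
  have hclmaps : ∀ (x : G) ⦃z : H⦄, z ∈ (Submodule.span ℂ S).topologicalClosure →
      π x z ∈ (Submodule.span ℂ S).topologicalClosure := fun x z hz => by
    have hcl := (hXmaps x).closure (π x).continuous
    rw [← Submodule.topologicalClosure_coe] at hcl
    exact hcl hz
  obtain ⟨W, hW⟩ : ∃ W : ContRepresentation.ClosedSubrep π,
      W.toSubmodule = (Submodule.span ℂ S).topologicalClosure :=
    ⟨⟨⟨(Submodule.span ℂ S).topologicalClosure, hclmaps⟩,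
      Submodule.isClosed_topologicalClosure _⟩, rfl⟩
  -- `u` is orthogonal to `S`: `⟪π (ι g) y, u⟫ = ⟪y, π (ι g⁻¹) u⟫ = 0`
  have hperp : Submodule.span ℂ S ≤ (ℂ ∙ u)ᗮ := by
    rw [Submodule.span_le]
    rintro _ ⟨g, y, hy, rfl⟩
    refine (Submodule.mem_orthogonal_singleton_iff_inner_left (𝕜 := ℂ)).2 ?_
    rw [← ContinuousLinearMap.adjoint_inner_right, hU.adjoint_apply, ← map_inv]
    exact hall g⁻¹ y hy
  rcases ((ContRepresentation.isTopIrreducible_iff π).1 hirr).2 W with hbot | htop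
  · -- `W = 0` contradicts `0 ≠ f ∈ S`
    apply hf0
    have hfW : f ∈ W := by
      rw [← ContRepresentation.ClosedSubrep.mem_toSubmodule, hW]
      refine Submodule.le_topologicalClosure _ (Submodule.subset_span ⟨1, f, hf, ?_⟩)
      rw [map_one, map_one, one_apply_eq_self]
    rwa [hbot, ContRepresentation.ClosedSubrep.mem_bot] at hfW
  · -- `W = H` forces `u ⊥ u`
    apply hu0
    have h1 : (Submodule.span ℂ S).topologicalClosure = ⊤ := by
      rw [← hW, htop, ContRepresentation.ClosedSubrep.toSubmodule_top]
    have h2 : (Submodule.span ℂ S).topologicalClosure ≤ (ℂ ∙ u)ᗮ :=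
      Submodule.topologicalClosure_minimal _ hperp (Submodule.isClosed_orthogonal _)
    rw [h1] at h2
    exact inner_self_eq_zero.1
      ((Submodule.mem_orthogonal_singleton_iff_inner_left (𝕜 := ℂ)).1 (h2 Submodule.mem_top))

/-- **Abstract peel.** Let `π` be a topologically irreducible unitary representation of
`G = ι(G₀) · C_G(ι(G₀))` with a non-zero `ι(U)`-fixed vector (`U ≤ G₀`), and let `L, L' ≤ G` be two
levels such that every `k ∈ L'` factors as `k = c · ι(t)` with `t ∈ U` and `c ∈ L` centralising
`ι(G₀)`. If `π` has a non-zero `L`-fixed vector `u`, it has a non-zero `L'`-fixed vector: the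
orthogonal projection `w` onto `H^{ι(U)}` of a translate `π(ι g) u` not orthogonal to `H^{ι(U)}`
(`exists_inner_apply_ne_zero`) is non-zero, `ι(U)`-fixed, and fixed by every such `c`, because the
projection commutes with `π(c)` (`starProjection_apply_eq_apply_starProjection`) and
`π(c) π(ι g) u = π(ι g) π(c) u = π(ι g) u` (Bump (1997), §3.3–3.4; Getz–Hahn (2024), §5.7). -/
theorem fixedPoints_ne_bot_of_level_peel {π : ContRepresentation ℂ G H} (hU : π.IsUnitary)
    (hirr : π.IsTopIrreducible) (ι : G₀ →* G)
    (hgen : ∀ x : G, ∃ (l : G₀) (c : G), c ∈ Subgroup.centralizer (Set.range ι) ∧ x = ι l * c)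
    (U : Subgroup G₀) {f : H} (hf : f ∈ π.toRepresentation.fixedPoints (U.map ι)) (hf0 : f ≠ 0)
    {L L' : Subgroup G}
    (hLL' : ∀ k ∈ L', ∃ t ∈ U, k * (ι t)⁻¹ ∈ L ∧ k * (ι t)⁻¹ ∈ Subgroup.centralizer (Set.range ι))
    (hL : π.toRepresentation.fixedPoints L ≠ ⊥) : π.toRepresentation.fixedPoints L' ≠ ⊥ := by
  obtain ⟨u, hu, hu0⟩ := (Submodule.ne_bot_iff _).1 hL
  obtain ⟨g, y, hy, hyu⟩ := exists_inner_apply_ne_zero hU hirr ι hgen U hf hf0 hu0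
  -- the closed subspace of `ι(U)`-fixed vectors and its orthogonal projection
  have hFclosed : IsClosed (π.toRepresentation.fixedPoints (U.map ι) : Set H) :=
    isClosed_fixedPoints π (U.map ι)
  haveI : CompleteSpace (π.toRepresentation.fixedPoints (U.map ι)) := hFclosed.completeSpace_coe
  have hFc : ∀ c ∈ Subgroup.centralizer (Set.range ι), ∀ z ∈ π.toRepresentation.fixedPoints (U.map ι),
      π c z ∈ π.toRepresentation.fixedPoints (U.map ι) := fun c hc z hz =>
    apply_mem_fixedPoints_map_of_mem_centralizer π ι U hc hz
  have hPc : ∀ c ∈ Subgroup.centralizer (Set.range ι), ∀ z : H,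
      (π.toRepresentation.fixedPoints (U.map ι)).starProjection (π c z) =
        π c ((π.toRepresentation.fixedPoints (U.map ι)).starProjection z) := fun c hc z =>
    starProjection_apply_eq_apply_starProjection hU (hFc c hc) (hFc c⁻¹ (inv_mem hc)) z
  -- the projection `w` of the translate `π (ι g) u`
  have hw0 : (π.toRepresentation.fixedPoints (U.map ι)).starProjection (π (ι g) u) ≠ 0 := by
    intro h0
    rw [Submodule.starProjection_apply_eq_zero_iff] at h0
    exact hyu ((Submodule.mem_orthogonal _ _).1 h0 y hy)
  have hwF : (π.toRepresentation.fixedPoints (U.map ι)).starProjection (π (ι g) u) ∈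
      π.toRepresentation.fixedPoints (U.map ι) := Submodule.starProjection_apply_mem _ _
  refine (Submodule.ne_bot_iff _).2 ⟨_, ?_, hw0⟩
  rw [Representation.mem_fixedPoints]
  intro k hk
  obtain ⟨t, ht, hkL, hkc⟩ := hLL' k hk
  have hsw : π (ι t) ((π.toRepresentation.fixedPoints (U.map ι)).starProjection (π (ι g) u)) =
      (π.toRepresentation.fixedPoints (U.map ι)).starProjection (π (ι g) u) :=
    (Representation.mem_fixedPoints _ _ _).1 hwF (ι t) ⟨t, ht, rfl⟩
  have hcu : π (k * (ι t)⁻¹) u = u := (Representation.mem_fixedPoints _ _ _).1 hu _ hkL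
  have hcomm : ι g * (k * (ι t)⁻¹) = k * (ι t)⁻¹ * ι g :=
    Subgroup.mem_centralizer_iff.1 hkc (ι g) ⟨g, rfl⟩
  change π k ((π.toRepresentation.fixedPoints (U.map ι)).starProjection (π (ι g) u)) = _
  calc π k ((π.toRepresentation.fixedPoints (U.map ι)).starProjection (π (ι g) u))
      = π (k * (ι t)⁻¹ * ι t)
          ((π.toRepresentation.fixedPoints (U.map ι)).starProjection (π (ι g) u)) := by
        rw [inv_mul_cancel_right]
    _ = π (k * (ι t)⁻¹)
          ((π.toRepresentation.fixedPoints (U.map ι)).starProjection (π (ι g) u)) := by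
        rw [map_mul, mul_apply_eq_comp, hsw]
    _ = (π.toRepresentation.fixedPoints (U.map ι)).starProjection (π (k * (ι t)⁻¹) (π (ι g) u)) :=
        (hPc _ hkc _).symm
    _ = (π.toRepresentation.fixedPoints (U.map ι)).starProjection (π (ι g) (π (k * (ι t)⁻¹) u)) := by
        rw [← mul_apply_eq_comp (π (k * (ι t)⁻¹)) (π (ι g)) u, ← map_mul, ← hcomm, map_mul,
          mul_apply_eq_comp]
    _ = (π.toRepresentation.fixedPoints (U.map ι)).starProjection (π (ι g) u) := by rw [hcu]

end Abstract

/-! ### `GL_n`: peeling the primes outside `S` off a level -/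

section GLn

variable {n : ℕ} {K : Type} [Field K] [NumberField K]

/-- An element of `GL_n(𝔸_K)` with trivial `v`-component centralises `ι_v(GL_n(K_v))`
(`GLn.ofLocal_mul_eq_mul_ofLocal_of_toLocal_eq_one`; Bump (1997), §3.3). -/
theorem mem_centralizer_range_ofLocal {v : HeightOneSpectrum (𝓞 K)}
    {c : GL (Fin n) (AdeleRing (𝓞 K) K)}
    (hc : Matrix.GeneralLinearGroup.map (AdelicGroupData.adeleEval K v) c = 1) :
    c ∈ Subgroup.centralizer (Set.range (GLn.ofLocal n K v)) := by
  rw [Subgroup.mem_centralizer_iff]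
  rintro _ ⟨t, rfl⟩
  exact GLn.ofLocal_mul_eq_mul_ofLocal_of_toLocal_eq_one t hc

/-- `k · ι_v(k_v)⁻¹` has trivial `v`-component (`GLn.toLocal_ofLocal`; Bump (1997), §3.3). -/
theorem map_adeleEval_mul_ofLocal_toLocal_inv (v : HeightOneSpectrum (𝓞 K))
    (k : GL (Fin n) (AdeleRing (𝓞 K) K)) :
    Matrix.GeneralLinearGroup.map (AdelicGroupData.adeleEval K v)
      (k * (GLn.ofLocal n K v ((AdelicGroupData.gl n K).toLocal v k))⁻¹) = 1 := by
  rw [map_mul, map_inv, GLn.map_adeleEval_ofLocal]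
  exact mul_inv_cancel ((AdelicGroupData.gl n K).toLocal v k)

variable {μ : Measure (AdelicGroupData.gl n K).automorphicQuotient}
  [(AdelicGroupData.gl n K).IsAutomorphicMeasure μ]

/-- **One-prime peel.** Let `Q` be a cuspidal automorphic representation of `GL_n(𝔸_K)` unramified
at `v`, and `𝔫' ≠ 0` an ideal prime to `v`. If `Q` has a non-zero `K(𝔭_v^e 𝔫')`-fixed vector then it
has a non-zero `K(𝔫')`-fixed vector: `fixedPoints_ne_bot_of_level_peel` for the irreducible unitary
`Q ≤ L²` (`ClosedSubrep.isUnitary_toContRep`), `ι_v = GLn.ofLocal`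
(`GLn.exists_eq_ofLocal_mul_centralizer`), `U = GL_n(𝒪_v)` (a Satake
eigenvector of `Q` at a level prime to `v` is `ι_v(GL_n(𝒪_v))`-fixed,
`isMaximalAt_principalCongruenceLevel`) and the factorisation `k = (k ι_v(k_v)⁻¹) ι_v(k_v)` of
`k ∈ K(𝔫')` with `k ι_v(k_v)⁻¹ ∈ K(𝔭_v^e 𝔫')` trivial at `v`
(`mul_ofLocal_toLocal_inv_mem_principalCongruenceLevel`; Bump (1997), §3.3; Flath (1979), Thm. 3). -/
theorem fixedVectors_principalCongruenceLevel_ne_bot_of_isUnramifiedAt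
    (Q : CuspidalAutomorphicRepGL n K μ) {v : HeightOneSpectrum (𝓞 K)} (hv : IsUnramifiedAt Q.1 v)
    {𝔫' : Ideal (𝓞 K)} (h𝔫' : 𝔫' ≠ 0) (hv𝔫' : ¬ v.asIdeal ∣ 𝔫') (e : ℕ)
    (h : Q.1.fixedVectors (principalCongruenceLevel n K (v.asIdeal ^ e * 𝔫')) ≠ ⊥) :
    Q.1.fixedVectors (principalCongruenceLevel n K 𝔫') ≠ ⊥ := by
  have hU : Q.1.toContRep.IsUnitary :=
    ClosedSubrep.isUnitary_toContRep ((AdelicGroupData.gl n K).isUnitary_rightRegular μ) Q.1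
  -- a non-zero `ι_v(GL_n(𝒪_v))`-fixed vector from unramifiedness
  obtain ⟨𝔪, h𝔪, hv𝔪, f, hf, hf0⟩ := hv.exists_mem_fixedVectors
  have hfU : f ∈ Q.1.toContRep.toRepresentation.fixedPoints
      ((valuedCongruenceSubgroup (Fin n) (1 : WithZero (Multiplicative ℤ))).map (GLn.ofLocal n K v)) :=
    Q.1.fixedVectors_antitone (isMaximalAt_principalCongruenceLevel n K v h𝔪 hv𝔪) hf
  refine fixedPoints_ne_bot_of_level_peel hU Q.2.2 (GLn.ofLocal n K v)
    (GLn.exists_eq_ofLocal_mul_centralizer v) _ hfU hf0 (fun k hk => ?_) h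
  -- the factorisation `k = (k ι_v(k_v)⁻¹) ι_v(k_v)` of `k ∈ K(𝔫')`
  exact ⟨(AdelicGroupData.gl n K).toLocal v k,
    toLocal_mem_valuedCongruenceSubgroup_one (principalCongruenceLevel_le n K 𝔫' hk) v,
    mul_ofLocal_toLocal_inv_mem_principalCongruenceLevel h𝔫' hv𝔫' e hk,
    mem_centralizer_range_ofLocal (map_adeleEval_mul_ofLocal_toLocal_inv v k)⟩

/-- **Simultaneous spherical vector (a level supported on `S`).** A cuspidal automorphic
representation `Q` of `GL_n(𝔸_K)` unramified at every finite place outside `S` has a non-zero vector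
fixed by a principal congruence subgroup `K(𝔫)`, `𝔫 ≠ 0`, all of whose prime divisors lie in `S`:
start from a level `𝔫₀` of `Q` (`exists_fixedVectors_principalCongruenceLevel_ne_bot_holds`) and peel
off its primes outside `S` one at a time (`WfDvdMonoid.max_power_factor`,
`fixedVectors_principalCongruenceLevel_ne_bot_of_isUnramifiedAt`). Classically: `Q ≅ ⊗' Q_v` with
`Q_v^{GL_n(𝒪_v)} ≠ 0` for `v ∉ S` (Flath (1979), Thm. 3; Bump (1997), Thm. 3.3.3;
Borel–Jacquet (1979), §4.6). -/
theorem exists_level_supportedOn_of_isUnramifiedAt (Q : CuspidalAutomorphicRepGL n K μ)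
    {S : Set (HeightOneSpectrum (𝓞 K))} (hS : ∀ v ∉ S, IsUnramifiedAt Q.1 v) :
    ∃ 𝔫 : Ideal (𝓞 K), 𝔫 ≠ 0 ∧ (∀ w : HeightOneSpectrum (𝓞 K), w.asIdeal ∣ 𝔫 → w ∈ S) ∧
      Q.1.fixedVectors (principalCongruenceLevel n K 𝔫) ≠ ⊥ := by
  classical
  obtain ⟨𝔫₀, h𝔫₀, hQ₀⟩ := exists_fixedVectors_principalCongruenceLevel_ne_bot_holds Q
  -- peel off, one at a time, the primes of a finite set `F` disjoint from `S`
  have key : ∀ F : Finset (HeightOneSpectrum (𝓞 K)), (∀ v ∈ F, v ∉ S) →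
      ∃ 𝔫 : Ideal (𝓞 K), 𝔫 ≠ 0 ∧ (∀ v ∈ F, ¬ v.asIdeal ∣ 𝔫) ∧
        (∀ w : HeightOneSpectrum (𝓞 K), w.asIdeal ∣ 𝔫 → w.asIdeal ∣ 𝔫₀) ∧
        Q.1.fixedVectors (principalCongruenceLevel n K 𝔫) ≠ ⊥ := by
    intro F
    refine Finset.induction_on F (fun _ => ⟨𝔫₀, h𝔫₀, fun v hv => absurd hv (Finset.notMem_empty v),
      fun w hw => hw, hQ₀⟩) ?_
    intro v F hvF ih hF
    obtain ⟨𝔫, h𝔫, hF𝔫, hdiv, hQ𝔫⟩ := ih fun u hu => hF u (Finset.mem_insert_of_mem hu)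
    have hvS : v ∉ S := hF v (Finset.mem_insert_self v F)
    obtain ⟨e, 𝔫', hv𝔫', h𝔫eq⟩ := WfDvdMonoid.max_power_factor h𝔫 v.irreducible
    have h𝔫' : 𝔫' ≠ 0 := by
      rintro rfl
      exact h𝔫 (by rw [h𝔫eq, mul_zero])
    refine ⟨𝔫', h𝔫', fun u hu => ?_, fun w hw => hdiv w (h𝔫eq ▸ dvd_mul_of_dvd_right hw _), ?_⟩
    · rcases Finset.mem_insert.mp hu with rfl | hu
      · exact hv𝔫'
      · exact fun h => hF𝔫 u hu (h𝔫eq ▸ dvd_mul_of_dvd_right h _)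
    · rw [h𝔫eq] at hQ𝔫
      exact fixedVectors_principalCongruenceLevel_ne_bot_of_isUnramifiedAt Q (hS v hvS) h𝔫' hv𝔫' e
        hQ𝔫
  obtain ⟨𝔫, h𝔫, hF, hdiv, hQ𝔫⟩ :=
    key ((primesOf h𝔫₀).filter fun v => v ∉ S) fun v hv => (Finset.mem_filter.mp hv).2
  refine ⟨𝔫, h𝔫, fun w hw => ?_, hQ𝔫⟩
  by_contra hwS
  exact hF w (Finset.mem_filter.mpr ⟨(mem_primesOf_iff h𝔫₀).mpr (hdiv w hw), hwS⟩) hw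

end GLn

/-! ### The registered stub signature -/

namespace Ssv

/-- **Stub `stub_ssv` of the skeleton `PairLBoundaryJS` (line `Sketch`), verbatim**: the
simultaneous spherical vector — a cuspidal automorphic representation of `GL_n(𝔸_K)` unramified
off `S` has a non-zero `K(𝔫)`-fixed vector for some `𝔫 ≠ 0` supported on `S`
(`exists_level_supportedOn_of_isUnramifiedAt`; Flath (1979), Thm. 3; Bump (1997), §3.3). -/
theorem stub_ssv :
    ∀ {n : ℕ} {K : Type} [Field K] [NumberField K]
      {μ : Measure (gl n K).automorphicQuotient} [(gl n K).IsAutomorphicMeasure μ]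
      (Q : CuspidalAutomorphicRepGL n K μ) {S : Set (HeightOneSpectrum (𝓞 K))},
      (∀ v ∉ S, IsUnramifiedAt Q.1 v) →
      ∃ 𝔫 : Ideal (𝓞 K), 𝔫 ≠ 0 ∧ (∀ w : HeightOneSpectrum (𝓞 K), w.asIdeal ∣ 𝔫 → w ∈ S) ∧
        Q.1.fixedVectors (principalCongruenceLevel n K 𝔫) ≠ ⊥ :=
  fun Q _ hS => exists_level_supportedOn_of_isUnramifiedAt Q hS

end Ssv

end Summit.Langlands.Langlands.Theorems

end
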